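import Literature.MathematicalPhysics.QuantumLattice.HubbardLocalSpinOperators
import Literature.MathematicalPhysics.QuantumLattice.SusyTJLadderBookkeeping
import HarnessLib

/-!
# Local moments and the exchange bound `𝐒_x·𝐒_y ≤ ¼ m_x m_y` for lattice fermions

Topic `MathematicalPhysics/QuantumLattice` (family `hubbard`). For fermions with two spin states on a
finite ordered site set `Λ` (orbitals `Orb Λ = Λ ×ₗ Fin 2`, `0 = ↑`, `1 = ↓`; local spin operators
`fermionSpinPlus/Minus/Z`, `fermionSpinDot` of `HubbardLocalSpinOperators`) this file proves three
textbook operator facts and their consequence, a **moment-depletion ceiling** on spin structure factors: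

* the **local moment** (projector onto singly occupied `x`)
  `m_x = n_{x↑} + n_{x↓} - 2 n_{x↑} n_{x↓}` and `𝐒_x·𝐒_x = ¾ m_x`
  (Essler–Frahm–Göhmann–Klümper–Korepin (2005) §2.2.5, the interaction written through the squared
  local spin, eq. (2.76); Auerbach (1994) Ch. 3);
* the **exchange bound** `¼ m_x m_y - 𝐒_x·𝐒_y = ½ BᴴB ⪰ 0` for `x ≠ y`, with `B = b_{xy} m_x m_y`
  and `b_{xy} = c_{x↑}c_{y↓} - c_{x↓}c_{y↑}` the singlet-pair annihilator — the operator form of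
  "two spins ½ have `𝐒_x·𝐒_y ≤ ¼`, and `𝐒_x·𝐒_y` vanishes unless both sites are singly occupied"
  (Altland–Simons (2010) §2.2, exchange interaction `P_s(…)P_s = J(𝐒₁·𝐒₂ - ¼)`; Auerbach (1994) §3.2);
* the **Casimir-type bound** for a finite set `Y` of sites:
  `Σ_{x,y∈Y} 𝐒_x·𝐒_y ≤ ((|Y|+2)/4) Σ_{x∈Y} m_x` (total spin of the electrons in `Y` is at most half the
  number of singly occupied sites; Tasaki (2020) App. A.3, Lieb (1989));
* hence for any bipartition `Λ = A ⊔ Aᶜ` with `|A|, |Aᶜ| ≤ k` the **staggered structure factor**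
  `𝓢 = Σ_{x,y} ε_x ε_y 𝐒_x·𝐒_y` (`ε = +1` on `A`, `-1` on `Aᶜ`) obeys the operator inequality
  `𝓢 ≤ ((k+2)/2) Σ_x m_x = ((k+2)/2) (N̂ - 2 D̂)`, `D̂ = Σ_x n_{x↑}n_{x↓}`:
  a certified upper bracket on the double occupancy of a state gives a certified ceiling on its
  staggered magnetisation, with no solver.

Everything is a definition with a body or a proved theorem (CAR algebra only); no named fact.
Main declarations (namespace `FermionSpinMoment`): `localMoment`, `localMoment_eq_diagonal`,
`fermionSpinDot_self` (`𝐒_x·𝐒_x = ¾ m_x`), `singletPair`, `conjTranspose_singletPair_mul_self`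
(`b†b = ½ n_x n_y - 2 𝐒_x·𝐒_y`), `fermionSpinDot_mul_localMoment_mul_localMoment`,
`posSemidef_quarter_localMoment_mul_sub_fermionSpinDot` (`¼ m_x m_y - 𝐒_x·𝐒_y ⪰ 0`),
`posSemidef_localMoment_sub_mul` (`m_x m_y ≤ m_x`).

## References
* F. H. L. Essler, H. Frahm, F. Göhmann, A. Klümper, V. E. Korepin, *The One-Dimensional Hubbard
  Model*, Cambridge University Press (2005), §2.1 eq. (2.2), (2.8) (CAR), §2.2.5 eq. (2.66)–(2.76)
  (local spin operators; `n² = n` and the interaction through the squared local moment, eq. (2.76)).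
  [cite: EsslerEtAl2005, §2.2.5 eq. (2.76)]
* A. Altland, B. Simons, *Condensed Matter Field Theory*, 2nd ed., CUP (2010), §2.2 "Mott–Hubbard
  transition and the magnetic state": `P_s H' P_s = -(2t²/U) P_s (1 + a†_{1σ}a†_{2σ'}a_{1σ'}a_{2σ}) P_s
  = J (𝐒₁·𝐒₂ - ¼)` (the exchange identity on the singly occupied subspace).
  [cite: AltlandSimons2010, §2.2 (exchange interaction)]
* A. Auerbach, *Interacting Electrons and Quantum Magnetism*, Springer (1994), Ch. 3 (from Hubbard to
  t-J: singlet-pair operators). [cite: Auerbach1994, Ch. 3]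
* H. Tasaki, *Physics and Mathematics of Quantum Many-Body Systems*, Springer (2020), §9.3 and App. A.3.
  [cite: Tasaki2020, App. A.3]
-/

noncomputable section

namespace Literature.MathematicalPhysics.QuantumLattice

open Matrix Finset HubbardWave0 Literature.Probability.LatticeModels
open scoped ComplexOrder

namespace FermionSpinMoment

/-! ### CAR preliminaries -/

section CAR

variable {ι : Type*} [LinearOrder ι] [Fintype ι]

/-- `n_a` commutes with a bilinear `c†_p c_q` of two other orbitals (`[c†_a c_a, c†_p c_q] =
δ_{ap} c†_a c_q - δ_{aq} c†_p c_a = 0`). [cite: EsslerEtAl2005, §2.2 eq. (2.72)] -/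
theorem number_commute_creation_mul_annihilation {a p q : ι} (hap : a ≠ p) (haq : a ≠ q) :
    Commute (creation a * annihilation a) (creation p * annihilation q) := by
  have h := LiebThm1.creation_mul_annihilation_commutator a a p q
  rw [if_neg hap, if_neg haq, sub_zero, sub_eq_zero] at h
  exact h

/-- `c_b` commutes with `n_a` for `a ≠ b`. [cite: EsslerEtAl2005, §2.1 eq. (2.8)] -/
theorem annihilation_mul_number_of_ne {a b : ι} (hab : a ≠ b) :
    annihilation b * (creation a * annihilation a) = creation a * annihilation a * annihilation b := by
  have h2 : annihilation b * annihilation a = -(annihilation a * annihilation b) :=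
    eq_neg_of_add_eq_zero_left (annihilation_anticommute_holds b a)
  rw [← mul_assoc, annihilation_mul_creation, if_neg (Ne.symm hab), zero_sub, neg_mul, mul_assoc, h2]
  noncomm_ring

end CAR

section Lattice

variable {Λ : Type*} [LinearOrder Λ] [Fintype Λ]

omit [LinearOrder Λ] [Fintype Λ] in
/-- Distinct sites have distinct orbitals. [folklore] -/
private theorem orb_ne_orb_of_ne {x y : Λ} (hxy : x ≠ y) (σ τ : Fin 2) : orb x σ ≠ orb y τ :=
  fun h => hxy (orb_eq_orb_iff.1 h).1

omit [LinearOrder Λ] [Fintype Λ] in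
/-- The two orbitals of one site are distinct. [folklore] -/
private theorem orb_up_ne_orb_down (x : Λ) : orb x 0 ≠ orb x 1 :=
  fun h => absurd (orb_eq_orb_iff.1 h).2 (by decide)

/-! ### The local moment `m_x` -/

/-- **The local moment operator** `m_x = n_{x↑} + n_{x↓} - 2 n_{x↑}n_{x↓}` = the projection onto the
configurations in which `x` is singly occupied (`m_x = (n_{x↑} - n_{x↓})² = (4/3) 𝐒_x²`).
[cite: EsslerEtAl2005, §2.2.5 eq. (2.76)] -/
def localMoment (x : Λ) : Matrix (Finset (Orb Λ)) (Finset (Orb Λ)) ℂ :=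
  numberOp x 0 + numberOp x 1 - (2 : ℂ) • (numberOp x 0 * numberOp x 1)

/-- The eigenvalue of `m_x` on the occupation-basis vector `|s⟩`: `1` iff exactly one of `x↑, x↓ ∈ s`.
[cite: EsslerEtAl2005, §2.2.5 eq. (2.76)] -/
def localMomentFun (x : Λ) (s : Finset (Orb Λ)) : ℂ :=
  if orb x 0 ∈ s then (if orb x 1 ∈ s then 0 else 1) else (if orb x 1 ∈ s then 1 else 0)

/-- `m_x` is diagonal in the occupation basis. [cite: EsslerEtAl2005, §2.2.5 eq. (2.76)] -/
theorem localMoment_eq_diagonal (x : Λ) : localMoment x = diagonal (localMomentFun x) := by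
  rw [localMoment, LiebThm1.numberOp_eq_diagonal, LiebThm1.numberOp_eq_diagonal, diagonal_mul_diagonal,
    diagonal_add, ← diagonal_smul, diagonal_sub]
  congr 1
  funext s
  simp only [localMomentFun, Pi.smul_apply, smul_eq_mul]
  split_ifs <;> norm_num

omit [Fintype Λ] in
/-- `m_x(s) ∈ {0, 1}` (`m_x` is a projection). [cite: EsslerEtAl2005, §2.2.5 eq. (2.76)] -/
theorem localMomentFun_mem (x : Λ) (s : Finset (Orb Λ)) :
    localMomentFun x s = 0 ∨ localMomentFun x s = 1 := by
  unfold localMomentFun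
  split_ifs <;> simp

/-- `m_x` is Hermitian. [cite: EsslerEtAl2005, §2.2.5 eq. (2.76)] -/
theorem isHermitian_localMoment (x : Λ) : (localMoment x).IsHermitian := by
  rw [localMoment_eq_diagonal]
  refine isHermitian_diagonal_of_self_adjoint _ (funext fun s => ?_)
  rcases localMomentFun_mem x s with h | h <;> simp [h]

/-- `m_x ⪰ 0`. [cite: EsslerEtAl2005, §2.2.5 eq. (2.76)] -/
theorem posSemidef_localMoment (x : Λ) : (localMoment x).PosSemidef := by
  rw [localMoment_eq_diagonal, posSemidef_diagonal_iff]
  intro s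
  rcases localMomentFun_mem x s with h | h <;> simp [h]

/-- `m_x - m_x m_y ⪰ 0` (`m_x m_y ≤ m_x`: both are commuting projections). [cite: EsslerEtAl2005, §2.2.5 eq. (2.76)] -/
theorem posSemidef_localMoment_sub_mul (x y : Λ) :
    (localMoment x - localMoment x * localMoment y).PosSemidef := by
  rw [localMoment_eq_diagonal, localMoment_eq_diagonal, diagonal_mul_diagonal, diagonal_sub,
    posSemidef_diagonal_iff]
  intro s
  rcases localMomentFun_mem x s with h | h <;> rcases localMomentFun_mem y s with h' | h' <;> simp [h, h']

/-- `(n_{x↑} + n_{x↓}) m_x = m_x` (a singly occupied site is occupied). [cite: EsslerEtAl2005, §2.2.5 eq. (2.76)] -/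
theorem number_mul_localMoment (x : Λ) :
    (numberOp x 0 + numberOp x 1) * localMoment x = localMoment x := by
  rw [localMoment_eq_diagonal, LiebThm1.numberOp_eq_diagonal, LiebThm1.numberOp_eq_diagonal, diagonal_add,
    diagonal_mul_diagonal]
  congr 1
  funext s
  unfold localMomentFun
  split_ifs <;> norm_num

/-- `m_x m_x = m_x`. [cite: EsslerEtAl2005, §2.2.5 eq. (2.76)] -/
theorem localMoment_mul_self (x : Λ) : localMoment x * localMoment x = localMoment x := by
  rw [localMoment_eq_diagonal, diagonal_mul_diagonal]
  congr 1
  funext s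
  rcases localMomentFun_mem x s with h | h <;> simp [h]

/-- `m_x m_y = m_y m_x`. [cite: EsslerEtAl2005, §2.2.5 eq. (2.76)] -/
theorem localMoment_comm (x y : Λ) : localMoment x * localMoment y = localMoment y * localMoment x := by
  rw [localMoment_eq_diagonal, localMoment_eq_diagonal, diagonal_mul_diagonal, diagonal_mul_diagonal]
  congr 1
  funext s
  ring

/-! ### `𝐒_x·𝐒_x = ¾ m_x` -/

/-- `S⁺_x S⁻_x = n_{x↑}(1 - n_{x↓}) = n_{x↑} - n_{x↑}n_{x↓}`. [cite: EsslerEtAl2005, §2.2.5 eq. (2.74)–(2.76)] -/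
theorem fermionSpinPlus_mul_fermionSpinMinus (x : Λ) :
    fermionSpinPlus x * fermionSpinMinus x = numberOp x 0 - numberOp x 0 * numberOp x 1 := by
  have hne := orb_up_ne_orb_down x
  calc fermionSpinPlus x * fermionSpinMinus x
      = creation (orb x 0) * (annihilation (orb x 1) * creation (orb x 1)) * annihilation (orb x 0) := by
        rw [fermionSpinPlus, fermionSpinMinus]; noncomm_ring
    _ = creation (orb x 0) * (1 - creation (orb x 1) * annihilation (orb x 1)) * annihilation (orb x 0) := by
        rw [annihilation_mul_creation, if_pos rfl]
    _ = numberOp x 0 - numberOp x 0 * numberOp x 1 := by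
        simp only [numberOp]
        rw [creation_annihilation_mul_creation_annihilation_of_ne hne]
        noncomm_ring

/-- `S⁻_x S⁺_x = n_{x↓}(1 - n_{x↑}) = n_{x↓} - n_{x↑}n_{x↓}`. [cite: EsslerEtAl2005, §2.2.5 eq. (2.74)–(2.76)] -/
theorem fermionSpinMinus_mul_fermionSpinPlus (x : Λ) :
    fermionSpinMinus x * fermionSpinPlus x = numberOp x 1 - numberOp x 0 * numberOp x 1 := by
  have hne := orb_up_ne_orb_down x
  calc fermionSpinMinus x * fermionSpinPlus x
      = creation (orb x 1) * (annihilation (orb x 0) * creation (orb x 0)) * annihilation (orb x 1) := by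
        rw [fermionSpinPlus, fermionSpinMinus]; noncomm_ring
    _ = creation (orb x 1) * (1 - creation (orb x 0) * annihilation (orb x 0)) * annihilation (orb x 1) := by
        rw [annihilation_mul_creation, if_pos rfl]
    _ = numberOp x 1 - numberOp x 0 * numberOp x 1 := by
        simp only [numberOp]
        rw [creation_annihilation_mul_creation_annihilation_of_ne hne,
          creation_creation_annihilation_annihilation_swap (orb x 0) (orb x 1) (orb x 1) (orb x 0)]
        noncomm_ring

/-- **`𝐒_x·𝐒_x = ¾ m_x`**: the squared spin of the electrons at one site is `¾` times the projection
onto single occupancy (spin ½ if singly occupied, spin 0 if empty or doubly occupied).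
[cite: EsslerEtAl2005, §2.2.5 eq. (2.76)] -/
theorem fermionSpinDot_self (x : Λ) : fermionSpinDot x x = (3 / 4 : ℂ) • localMoment x := by
  rw [fermionSpinDot, fermionSpinPlus_mul_fermionSpinMinus, fermionSpinMinus_mul_fermionSpinPlus, fermionSpinZ,
    localMoment, LiebThm1.numberOp_eq_diagonal, LiebThm1.numberOp_eq_diagonal]
  simp only [diagonal_mul_diagonal, diagonal_sub, diagonal_add, ← diagonal_smul]
  congr 1
  funext s
  simp only [Pi.smul_apply, smul_eq_mul]
  split_ifs <;> norm_num

/-- `Σ_{x∈Y} 𝐒_x·𝐒_x = ¾ Σ_{x∈Y} m_x`. [cite: EsslerEtAl2005, §2.2.5 eq. (2.76)] -/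
theorem sum_fermionSpinDot_self (Y : Finset Λ) :
    ∑ x ∈ Y, fermionSpinDot x x = (3 / 4 : ℂ) • ∑ x ∈ Y, localMoment x := by
  rw [Finset.smul_sum]
  exact Finset.sum_congr rfl fun x _ => fermionSpinDot_self x

/-! ### The exchange bound `𝐒_x·𝐒_y ≤ ¼ m_x m_y` -/

/-- The singlet-pair annihilator `b_{xy} = c_{x↑}c_{y↓} - c_{x↓}c_{y↑}`.
[cite: AltlandSimons2010, §2.2 (exchange interaction)] -/
def singletPair (x y : Λ) : Matrix (Finset (Orb Λ)) (Finset (Orb Λ)) ℂ :=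
  annihilation (orb x 0) * annihilation (orb y 1) - annihilation (orb x 1) * annihilation (orb y 0)

/-- **The singlet identity** `b†_{xy} b_{xy} = ½ n_x n_y - 2 𝐒_x·𝐒_y` (`x ≠ y`, `n_x = n_{x↑}+n_{x↓}`):
the number of singlet pairs on the bond. [cite: AltlandSimons2010, §2.2 (exchange interaction)] -/
theorem conjTranspose_singletPair_mul_self {x y : Λ} (hxy : x ≠ y) :
    (singletPair x y)ᴴ * singletPair x y =
      (1 / 2 : ℂ) • ((numberOp x 0 + numberOp x 1) * (numberOp y 0 + numberOp y 1)) -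
        (2 : ℂ) • fermionSpinDot x y := by
  have h := fun (σ τ : Fin 2) => orb_ne_orb_of_ne hxy σ τ
  have key : ∀ a e c b : Orb Λ, creation a * creation e * (annihilation c * annihilation b) =
      creation e * creation a * annihilation b * annihilation c := fun a e c b => by
    rw [← mul_assoc]; exact creation_creation_annihilation_annihilation_swap a e c b
  rw [fermionSpinDot_eq_normalOrder hxy, singletPair, conjTranspose_sub, conjTranspose_mul, conjTranspose_mul,
    annihilation_conjTranspose, annihilation_conjTranspose, annihilation_conjTranspose, annihilation_conjTranspose]
  simp only [sub_mul, mul_sub, add_mul, mul_add, numberOp, key,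
    creation_annihilation_mul_creation_annihilation_of_ne (h _ _)]
  module

/-- `S⁺_y` commutes with `m_x` for `x ≠ y` (`[S⁰_{xx}, S^α_y] = 0`). [cite: EsslerEtAl2005, §2.2.5 eq. (2.77)] -/
theorem localMoment_commute_fermionSpinPlus {x y : Λ} (hxy : x ≠ y) :
    Commute (localMoment x) (fermionSpinPlus y) := by
  have h := fun (σ τ : Fin 2) => orb_ne_orb_of_ne hxy σ τ
  have h0 : Commute (numberOp x 0) (fermionSpinPlus y) := number_commute_creation_mul_annihilation (h 0 0) (h 0 1)
  have h1 : Commute (numberOp x 1) (fermionSpinPlus y) := number_commute_creation_mul_annihilation (h 1 0) (h 1 1)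
  exact ((h0.add_left h1).sub_left ((h0.mul_left h1).smul_left _))

/-- `S⁻_y` commutes with `m_x` for `x ≠ y` (`[S⁰_{xx}, S^α_y] = 0`). [cite: EsslerEtAl2005, §2.2.5 eq. (2.77)] -/
theorem localMoment_commute_fermionSpinMinus {x y : Λ} (hxy : x ≠ y) :
    Commute (localMoment x) (fermionSpinMinus y) := by
  have h := fun (σ τ : Fin 2) => orb_ne_orb_of_ne hxy σ τ
  have h0 : Commute (numberOp x 0) (fermionSpinMinus y) := number_commute_creation_mul_annihilation (h 0 1) (h 0 0)
  have h1 : Commute (numberOp x 1) (fermionSpinMinus y) := number_commute_creation_mul_annihilation (h 1 1) (h 1 0)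
  exact ((h0.add_left h1).sub_left ((h0.mul_left h1).smul_left _))

/-- `S^z_y` commutes with `m_x` (`[S⁰_{xx}, S^z_y] = 0`). [cite: EsslerEtAl2005, §2.2.5 eq. (2.77)] -/
theorem localMoment_commute_fermionSpinZ (x y : Λ) : Commute (localMoment x) (fermionSpinZ y) := by
  rw [localMoment_eq_diagonal, fermionSpinZ, LiebThm1.numberOp_eq_diagonal, LiebThm1.numberOp_eq_diagonal,
    diagonal_sub, ← diagonal_smul]
  show diagonal _ * diagonal _ = diagonal _ * diagonal _
  rw [diagonal_mul_diagonal, diagonal_mul_diagonal]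
  congr 1; funext s; ring

/-- `S⁺_x m_x = S⁺_x` (a spin flip requires single occupancy: the local spin operators live on the
singly occupied subspace `P_s`). [cite: AltlandSimons2010, §2.2 (exchange interaction)] -/
theorem fermionSpinPlus_mul_localMoment (x : Λ) : fermionSpinPlus x * localMoment x = fermionSpinPlus x := by
  have hne := orb_up_ne_orb_down x
  -- `c†_↑ c_↓ n_↑ = c†_↑ n_↑ c_↓ = 0`, `c†_↑ c_↓ n_↓ = c†_↑ c_↓`
  have h1 : fermionSpinPlus x * numberOp x 0 = 0 := by
    rw [fermionSpinPlus, numberOp, mul_assoc, annihilation_mul_number_of_ne hne, ← mul_assoc, ← mul_assoc,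
      creation_mul_self, zero_mul, zero_mul]
  have h2 : fermionSpinPlus x * numberOp x 1 = fermionSpinPlus x := by
    rw [fermionSpinPlus, numberOp, mul_assoc, SusyTJ.annihilation_mul_number_self]
  rw [localMoment, mul_sub, mul_add, mul_smul_comm, ← mul_assoc, h1, h2, zero_mul, smul_zero, zero_add, sub_zero]

/-- `S⁻_x m_x = S⁻_x`. [cite: AltlandSimons2010, §2.2 (exchange interaction)] -/
theorem fermionSpinMinus_mul_localMoment (x : Λ) : fermionSpinMinus x * localMoment x = fermionSpinMinus x := by
  have hne := orb_up_ne_orb_down x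
  have h1 : fermionSpinMinus x * numberOp x 1 = 0 := by
    rw [fermionSpinMinus, numberOp, mul_assoc, annihilation_mul_number_of_ne hne.symm, ← mul_assoc, ← mul_assoc,
      creation_mul_self, zero_mul, zero_mul]
  have h2 : fermionSpinMinus x * numberOp x 0 = fermionSpinMinus x := by
    rw [fermionSpinMinus, numberOp, mul_assoc, SusyTJ.annihilation_mul_number_self]
  have h3 : numberOp x 0 * numberOp x 1 = numberOp x 1 * numberOp x 0 := numberAt_commute _ _
  rw [localMoment, h3, mul_sub, mul_add, mul_smul_comm, ← mul_assoc, h1, h2, zero_mul, smul_zero, add_zero,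
    sub_zero]

/-- `S^z_x m_x = S^z_x`. [cite: AltlandSimons2010, §2.2 (exchange interaction)] -/
theorem fermionSpinZ_mul_localMoment (x : Λ) : fermionSpinZ x * localMoment x = fermionSpinZ x := by
  rw [localMoment_eq_diagonal, fermionSpinZ, LiebThm1.numberOp_eq_diagonal, LiebThm1.numberOp_eq_diagonal,
    diagonal_sub, smul_mul_assoc, diagonal_mul_diagonal]
  congr 2; funext s
  unfold localMomentFun
  split_ifs <;> norm_num

/-- `(𝐒_x·𝐒_y) (m_x m_y) = 𝐒_x·𝐒_y` for `x ≠ y`: the exchange operator is supported on the configurations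
with both sites singly occupied. [cite: AltlandSimons2010, §2.2 (exchange interaction)] -/
theorem fermionSpinDot_mul_localMoment_mul_localMoment {x y : Λ} (hxy : x ≠ y) :
    fermionSpinDot x y * (localMoment x * localMoment y) = fermionSpinDot x y := by
  have hP : ∀ {X Y : Matrix (Finset (Orb Λ)) (Finset (Orb Λ)) ℂ}, X * localMoment x = X → Y * localMoment y = Y →
      Commute (localMoment x) Y → X * Y * (localMoment x * localMoment y) = X * Y := by
    intro X Y hX hY hc
    calc X * Y * (localMoment x * localMoment y) = X * (Y * localMoment x) * localMoment y := by noncomm_ring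
      _ = X * (localMoment x * Y) * localMoment y := by rw [hc.eq]
      _ = (X * localMoment x) * (Y * localMoment y) := by noncomm_ring
      _ = X * Y := by rw [hX, hY]
  rw [fermionSpinDot, add_mul, smul_mul_assoc, add_mul,
    hP (fermionSpinPlus_mul_localMoment x) (fermionSpinMinus_mul_localMoment y) (localMoment_commute_fermionSpinMinus hxy),
    hP (fermionSpinMinus_mul_localMoment x) (fermionSpinPlus_mul_localMoment y) (localMoment_commute_fermionSpinPlus hxy),
    hP (fermionSpinZ_mul_localMoment x) (fermionSpinZ_mul_localMoment y) (localMoment_commute_fermionSpinZ x y)]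

/-- **The exchange bound** `¼ m_x m_y - 𝐒_x·𝐒_y ⪰ 0` for `x ≠ y`: it equals `½ BᴴB` with
`B = b_{xy} m_x m_y` (`b†b = ½ n_x n_y - 2𝐒_x·𝐒_y`, `m_x m_y n_x n_y = m_x m_y`, `𝐒_x·𝐒_y m_x m_y = 𝐒_x·𝐒_y`).
The fermionic form of `𝐒_x·𝐒_y ≤ ¼` for two spins ½. [cite: AltlandSimons2010, §2.2 (exchange interaction)] -/
theorem posSemidef_quarter_localMoment_mul_sub_fermionSpinDot {x y : Λ} (hxy : x ≠ y) :
    ((1 / 4 : ℂ) • (localMoment x * localMoment y) - fermionSpinDot x y).PosSemidef := by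
  obtain ⟨P, hPdef⟩ : ∃ P : Matrix (Finset (Orb Λ)) (Finset (Orb Λ)) ℂ, P = localMoment x * localMoment y :=
    ⟨_, rfl⟩
  have hPh : Pᴴ = P := by
    rw [hPdef, conjTranspose_mul, (isHermitian_localMoment x).eq, (isHermitian_localMoment y).eq, localMoment_comm]
  have hPP : P * P = P := by
    rw [hPdef, localMoment_eq_diagonal, localMoment_eq_diagonal, diagonal_mul_diagonal, diagonal_mul_diagonal]
    congr 1
    funext s
    rcases localMomentFun_mem x s with h | h <;> rcases localMomentFun_mem y s with h' | h' <;> simp [h, h']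
  have hPN : P * ((numberOp x 0 + numberOp x 1) * (numberOp y 0 + numberOp y 1)) = P := by
    rw [hPdef, localMoment_eq_diagonal, localMoment_eq_diagonal, LiebThm1.numberOp_eq_diagonal,
      LiebThm1.numberOp_eq_diagonal, LiebThm1.numberOp_eq_diagonal, LiebThm1.numberOp_eq_diagonal,
      diagonal_add, diagonal_add, diagonal_mul_diagonal, diagonal_mul_diagonal, diagonal_mul_diagonal]
    congr 1
    funext s
    unfold localMomentFun
    split_ifs <;> norm_num
  have hSP : fermionSpinDot x y * P = fermionSpinDot x y := by
    rw [hPdef]; exact fermionSpinDot_mul_localMoment_mul_localMoment hxy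
  have hPS : P * fermionSpinDot x y = fermionSpinDot x y := by
    have := congrArg conjTranspose hSP
    rwa [conjTranspose_mul, hPh, (isHermitian_fermionSpinDot x y).eq] at this
  -- `B = b P`, `BᴴB = P (b†b) P = ½ P - 2 𝐒_x·𝐒_y`
  obtain ⟨B, hB⟩ : ∃ B : Matrix (Finset (Orb Λ)) (Finset (Orb Λ)) ℂ, B = singletPair x y * P := ⟨_, rfl⟩
  have hBB : Bᴴ * B = (1 / 2 : ℂ) • P - (2 : ℂ) • fermionSpinDot x y := by
    rw [hB, conjTranspose_mul, hPh]
    calc P * (singletPair x y)ᴴ * (singletPair x y * P)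
        = P * ((singletPair x y)ᴴ * singletPair x y) * P := by simp only [Matrix.mul_assoc]
      _ = P * ((1 / 2 : ℂ) • ((numberOp x 0 + numberOp x 1) * (numberOp y 0 + numberOp y 1)) -
            (2 : ℂ) • fermionSpinDot x y) * P := by rw [conjTranspose_singletPair_mul_self hxy]
      _ = (1 / 2 : ℂ) • (P * ((numberOp x 0 + numberOp x 1) * (numberOp y 0 + numberOp y 1)) * P) -
            (2 : ℂ) • (P * fermionSpinDot x y * P) := by
          rw [Matrix.mul_sub, Matrix.sub_mul, mul_smul_comm, smul_mul_assoc, mul_smul_comm, smul_mul_assoc]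
      _ = (1 / 2 : ℂ) • P - (2 : ℂ) • fermionSpinDot x y := by rw [hPN, hPP, hPS, hSP]
  have hquarter : (0 : ℂ) ≤ 1 / 4 := by
    rw [show (1 / 4 : ℂ) = ((1 / 4 : ℝ) : ℂ) by norm_num]
    exact Complex.zero_le_real.2 (by norm_num)
  have hpsd : ((1 / 4 : ℂ) • (Bᴴ * B) + (1 / 4 : ℂ) • (Bᴴ * B)).PosSemidef :=
    ((posSemidef_conjTranspose_mul_self B).smul hquarter).add ((posSemidef_conjTranspose_mul_self B).smul hquarter)
  have heq : (1 / 4 : ℂ) • (localMoment x * localMoment y) - fermionSpinDot x y =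
      (1 / 4 : ℂ) • (Bᴴ * B) + (1 / 4 : ℂ) • (Bᴴ * B) := by
    rw [hBB, hPdef]; module
  rw [heq]
  exact hpsd

end Lattice

end FermionSpinMoment

end Literature.MathematicalPhysics.QuantumLattice
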